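import Mathlib
import Summits.Ventures.PercRepro2.TypedBundleSepThree
import Summits.Ventures.PercRepro2.TypedPocketABTheorem
import Summits.Ventures.PercRepro2.TypedSepTwoOTheorem

/-!
# The domain of record without the `{a₃, b}`-pocket class and the (SEP-2) class (blind cell
PercRepro2, p2 g6, 2026-08-25; sub-claim S1 — p3 g6's two further typed classes composed on the
(SEP-3) layer; the lead's R-SEP3(5))

p3 g6's `PocketAB.typedCount_nonneg_of_hasPocketAB` (the doors `a₃, b` separate `o` from both roots —
root-symmetric, one conjunct) and `SepTwo.typedCount_eq_zero_of_hasSepTwo` (the roots separate `o`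
from `b`, `a₃` on either side — `HasSepTwoB ∨ HasSepTwoO`, root-symmetric, one conjunct), composed
in the `by_cases` pattern of every layer:

* **`ResidualCoreNHatCTBRASUDO7SP := ResidualCoreNHatCTBRASUDO7S ∧ ¬HasPocketAB`**,
  **`HCov_all_of_residualCoreNHatCTBRASUDO7SP_all`**; the flat form **`FlatDomain7SP_all`** (fifteen
  conditions), **`HCov_all_of_flat7SP_all`**;
* **`ResidualCoreNHatCTBRASUDO7SP2 := ResidualCoreNHatCTBRASUDO7SP ∧ ¬HasSepTwo`**,
  **`HCov_all_of_residualCoreNHatCTBRASUDO7SP2_all`**; the flat form **`FlatDomain7SP2_all`** (sixteen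
  conditions), **`HCov_all_of_flat7SP2_all`** — all UNCONDITIONAL.

Own code; standard axioms.
-/

namespace Summit.Ventures.PercRepro2

open UnionCluster

namespace CovForm

namespace TypedRed

section CorePocket

variable {V : Type*} {E : Type*} [DecidableEq V] [Fintype E] [DecidableEq E]

/-- **The domain of record without the `{a₃, b}`-pocket class.** -/
structure ResidualCoreNHatCTBRASUDO7SP (ends : E → Sym2 V) (o a₁ a₂ a₃ b : V) (F : Finset E) :
    Prop where
  coreNHatCTBRASUDO7S : ResidualCoreNHatCTBRASUDO7S ends o a₁ a₂ a₃ b F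
  not_pocketAB : ¬ PocketAB.HasPocketAB ends o a₁ a₂ a₃ b F

/-- **The domain of record without the pocket class and the (SEP-2) class.** -/
structure ResidualCoreNHatCTBRASUDO7SP2 (ends : E → Sym2 V) (o a₁ a₂ a₃ b : V) (F : Finset E) :
    Prop where
  coreNHatCTBRASUDO7SP : ResidualCoreNHatCTBRASUDO7SP ends o a₁ a₂ a₃ b F
  not_sepTwo : ¬ SepTwo.HasSepTwo ends o a₁ a₂ a₃ b F

end CorePocket

section ClosurePocket

variable (R : Type*) [Field R] [LinearOrder R] [IsStrictOrderedRing R]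

/-- **Row 2′TRI on `ResidualCoreNHatCTBRASUDO7SP`, over every finite graph.** -/
def ResidualCoreNHatCTBRASUDO7SP_all : Prop :=
  ∀ (V E : Type) [Fintype V] [DecidableEq V] [Fintype E] [DecidableEq E]
    (ends : E → Sym2 V) (o a₁ a₂ a₃ b : V) (F : Finset E) (τ : E → ℕ),
    (∀ e ∈ F, τ e = 1 ∨ τ e = 2) → ResidualCoreNHatCTBRASUDO7SP ends o a₁ a₂ a₃ b F →
      0 ≤ typedCount F (fun _ => false) τ
        (K3 ends o a₁ a₂ a₃ b : Config E → Config E → Config E → R)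

/-- **THE CRUX OF RECORD FROM (TRI) ON THE DOMAIN WITHOUT THE POCKET CLASS** — unconditional. -/
theorem HCov_all_of_residualCoreNHatCTBRASUDO7SP_all (hc : ResidualCoreNHatCTBRASUDO7SP_all R) :
    HCov_all R := by
  refine HCov_all_of_residualCoreNHatCTBRASUDO7S_all R ?_
  intro V E _ _ _ _ ends o a₁ a₂ a₃ b F τ hτ hdom
  by_cases hp : PocketAB.HasPocketAB ends o a₁ a₂ a₃ b F
  · exact PocketAB.typedCount_nonneg_of_hasPocketAB ends o a₁ a₂ a₃ b F τ hp
  exact hc V E ends o a₁ a₂ a₃ b F τ hτ ⟨hdom, hp⟩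

/-- **Row 2′TRI on `ResidualCoreNHatCTBRASUDO7SP2`, over every finite graph.** -/
def ResidualCoreNHatCTBRASUDO7SP2_all : Prop :=
  ∀ (V E : Type) [Fintype V] [DecidableEq V] [Fintype E] [DecidableEq E]
    (ends : E → Sym2 V) (o a₁ a₂ a₃ b : V) (F : Finset E) (τ : E → ℕ),
    (∀ e ∈ F, τ e = 1 ∨ τ e = 2) → ResidualCoreNHatCTBRASUDO7SP2 ends o a₁ a₂ a₃ b F →
      0 ≤ typedCount F (fun _ => false) τ
        (K3 ends o a₁ a₂ a₃ b : Config E → Config E → Config E → R)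

/-- **THE CRUX OF RECORD FROM (TRI) ON THE DOMAIN WITHOUT THE POCKET AND (SEP-2) CLASSES** —
unconditional. -/
theorem HCov_all_of_residualCoreNHatCTBRASUDO7SP2_all (hc : ResidualCoreNHatCTBRASUDO7SP2_all R) :
    HCov_all R := by
  refine HCov_all_of_residualCoreNHatCTBRASUDO7SP_all R ?_
  intro V E _ _ _ _ ends o a₁ a₂ a₃ b F τ hτ hdom
  by_cases hs : SepTwo.HasSepTwo ends o a₁ a₂ a₃ b F
  · exact le_of_eq (SepTwo.typedCount_eq_zero_of_hasSepTwo ends o a₁ a₂ a₃ b F τ hs).symm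
  exact hc V E ends o a₁ a₂ a₃ b F τ hτ ⟨hdom, hs⟩

/-- **Row 2′TRI on the flat domain without the pocket class, over every finite graph** (fifteen
conditions). -/
def FlatDomain7SP_all : Prop :=
  ∀ (V E : Type) [Fintype V] [DecidableEq V] [Fintype E] [DecidableEq E]
    (ends : E → Sym2 V) (o a₁ a₂ a₃ b : V) (F : Finset E) (τ : E → ℕ),
    (∀ e ∈ F, τ e = 1 ∨ τ e = 2) →
    ResidualCore ends o a₁ a₂ a₃ b F →
    ¬ Hats ends o a₁ a₂ a₃ b F →
    ¬ HasRootCut ends o a₁ a₂ a₃ b F →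
    ¬ HasTwoTerminalPart ends o a₁ a₂ a₃ b F →
    ¬ HasRootBundle ends o a₁ a₂ a₃ b F →
    ¬ RootBridge.HasCutRoots ends o a₁ a₂ a₃ b F →
    ¬ RootBridge.HasCutRootsA3 ends o a₁ a₂ a₃ b F →
    ¬ OneStar ends o a₁ a₂ a₃ b F →
    ¬ RootBridge.MildInst ends o a₁ a₂ a₃ b F (fun _ => false) →
    o ≠ b →
    ¬ RootBridge.OBehindA3 ends o a₁ a₂ a₃ F (fun _ => false) →
    7 ≤ F.card →
    ¬ SepThree.HasSepThree ends o a₁ a₂ a₃ b F →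
    ¬ SepThree.HasSepThree ends o a₂ a₁ a₃ b F →
    ¬ PocketAB.HasPocketAB ends o a₁ a₂ a₃ b F →
      0 ≤ typedCount F (fun _ => false) τ
        (K3 ends o a₁ a₂ a₃ b : Config E → Config E → Config E → R)

/-- **THE CRUX OF RECORD FROM (TRI) ON THE FLAT DOMAIN WITHOUT THE POCKET CLASS** — fifteen
conditions. -/
theorem HCov_all_of_flat7SP_all (hc : FlatDomain7SP_all R) : HCov_all R := by
  refine HCov_all_of_residualCoreNHatCTBRASUDO7SP_all R ?_
  intro V E _ _ _ _ ends o a₁ a₂ a₃ b F τ hτ hdom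
  obtain ⟨h0, h1, h2, h3, h4, h5, h6, h7, h8, h9, h10⟩ :=
    (ResidualCoreNHatCTBRASUDO_iff ends o a₁ a₂ a₃ b F).1
      hdom.coreNHatCTBRASUDO7S.coreNHatCTBRASUDO7.coreNHatCTBRASUDO
  exact hc V E ends o a₁ a₂ a₃ b F τ hτ h0 h1 h2 h3 h4 h5 h6 h7 h8 h9 h10
    hdom.coreNHatCTBRASUDO7S.coreNHatCTBRASUDO7.seven_le hdom.coreNHatCTBRASUDO7S.not_sepThree
    hdom.coreNHatCTBRASUDO7S.not_sepThree_mirror hdom.not_pocketAB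

/-- **Row 2′TRI on the flat domain without the pocket and (SEP-2) classes, over every finite
graph** (sixteen conditions). -/
def FlatDomain7SP2_all : Prop :=
  ∀ (V E : Type) [Fintype V] [DecidableEq V] [Fintype E] [DecidableEq E]
    (ends : E → Sym2 V) (o a₁ a₂ a₃ b : V) (F : Finset E) (τ : E → ℕ),
    (∀ e ∈ F, τ e = 1 ∨ τ e = 2) →
    ResidualCore ends o a₁ a₂ a₃ b F →
    ¬ Hats ends o a₁ a₂ a₃ b F →
    ¬ HasRootCut ends o a₁ a₂ a₃ b F →
    ¬ HasTwoTerminalPart ends o a₁ a₂ a₃ b F →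
    ¬ HasRootBundle ends o a₁ a₂ a₃ b F →
    ¬ RootBridge.HasCutRoots ends o a₁ a₂ a₃ b F →
    ¬ RootBridge.HasCutRootsA3 ends o a₁ a₂ a₃ b F →
    ¬ OneStar ends o a₁ a₂ a₃ b F →
    ¬ RootBridge.MildInst ends o a₁ a₂ a₃ b F (fun _ => false) →
    o ≠ b →
    ¬ RootBridge.OBehindA3 ends o a₁ a₂ a₃ F (fun _ => false) →
    7 ≤ F.card →
    ¬ SepThree.HasSepThree ends o a₁ a₂ a₃ b F →
    ¬ SepThree.HasSepThree ends o a₂ a₁ a₃ b F →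
    ¬ PocketAB.HasPocketAB ends o a₁ a₂ a₃ b F →
    ¬ SepTwo.HasSepTwo ends o a₁ a₂ a₃ b F →
      0 ≤ typedCount F (fun _ => false) τ
        (K3 ends o a₁ a₂ a₃ b : Config E → Config E → Config E → R)

/-- **THE CRUX OF RECORD FROM (TRI) ON THE FLAT DOMAIN WITHOUT THE POCKET AND (SEP-2) CLASSES** —
the sentence of record in one statement, sixteen conditions. -/
theorem HCov_all_of_flat7SP2_all (hc : FlatDomain7SP2_all R) : HCov_all R := by
  refine HCov_all_of_residualCoreNHatCTBRASUDO7SP2_all R ?_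
  intro V E _ _ _ _ ends o a₁ a₂ a₃ b F τ hτ hdom
  obtain ⟨h0, h1, h2, h3, h4, h5, h6, h7, h8, h9, h10⟩ :=
    (ResidualCoreNHatCTBRASUDO_iff ends o a₁ a₂ a₃ b F).1
      hdom.coreNHatCTBRASUDO7SP.coreNHatCTBRASUDO7S.coreNHatCTBRASUDO7.coreNHatCTBRASUDO
  exact hc V E ends o a₁ a₂ a₃ b F τ hτ h0 h1 h2 h3 h4 h5 h6 h7 h8 h9 h10
    hdom.coreNHatCTBRASUDO7SP.coreNHatCTBRASUDO7S.coreNHatCTBRASUDO7.seven_le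
    hdom.coreNHatCTBRASUDO7SP.coreNHatCTBRASUDO7S.not_sepThree
    hdom.coreNHatCTBRASUDO7SP.coreNHatCTBRASUDO7S.not_sepThree_mirror
    hdom.coreNHatCTBRASUDO7SP.not_pocketAB hdom.not_sepTwo

end ClosurePocket

end TypedRed

end CovForm

end Summit.Ventures.PercRepro2
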